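import Summits.Ventures.PercRepro.S2TwelveCaps
import Summits.Ventures.PercRepro.S2FlatSharp
import Summits.Ventures.PercRepro.S2TailFlats
import Summits.Ventures.PercRepro.S2CountsCell
import Summits.Ventures.PercRepro.S2DichotomyTools

/-!
# PercRepro — S2: THE SPREAD CASE OF THE COLOOP-FREE CELL `(13, 12)` ON THE GLOBAL CAPS (p7, gen 19; sub-claim S2; the row `p = 13`)

On a spread `e`-free core of rank `13` on `25` points without coloops (no set of nullity `4` on `≤ 9` points: the rank-`5`
sets have `≤ 8` points, the rank-`4` sets `≤ 7`) the GLOBAL caps `29 / 297 / 2760` (`caps_thirteen_twelve_cf`; no spread cap is needed at corank `12`)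
feed the kit's spread levers: the top count by `topCount_le_flat_sharp` at `(f, f′) = (8, 7)` (`#U ≤ 1514629 / 5 < 302926`), the tail by flats at
`(8, 7)` (`1819578 / 5`) and the spanning count by the kit (`Σ_{m ≤ 12} C(25, m) = 16777216`): `m = 524`, the need `(1024 − 524)·128·9480/1024 = 592500.0` —
ratio `0.51`. **`c025_thirteen_twelve_cf_spread`**. Nothing about the cell is claimed. Axioms: standard.
-/

open scoped Matroid

namespace PercRepro

namespace ThmN

open Set

variable {α : Type}

/-- **The spread case of the coloop-free cell `(13, 12)`**, on the global caps (`#U ≤ 302926`, `m = 524`). -/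
theorem c025_thirteen_twelve_cf_spread (M : Matroid α) [M.Finite]
    (hR : M.eRank = ((13 : ℕ) : ℕ∞)) (hn : M.E.ncard = 13 + 12)
    (hfree : ∀ e ∈ M.E, ∃ A ⊆ M.E \ {e}, e ∉ M.closure A ∧ e ∉ M.closure ((M.E \ {e}) \ A)) (hK : ∀ e, ¬ M.IsColoop e)
    (h4 : ¬ ∃ W ⊆ M.E, W.ncard ≤ 9 ∧ W.encard = M.eRk W + 4) :
    RLS M 13 5 := by
  classical
  have hd : M.E.encard = M.eRank + ((12 : ℕ) : ℕ∞) := by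
    rw [hR, ← M.ground_finite.cast_ncard_eq, hn]
    push_cast
    ring
  obtain ⟨hs3, hs4, hs5⟩ := caps_thirteen_twelve_cf M hd hn hfree hK
  have hflat : ∀ X ⊆ M.E, M.eRk X ≤ 5 → X.ncard ≤ 8 := fun X hX hr => by
    have := S2.ncard_le_of_eRk_le_of_not_nullity M 4 9 (by norm_num) h4 hX (r := 5) (by norm_num) (by exact_mod_cast hr)
    omega
  have hflat' : ∀ X ⊆ M.E, M.eRk X ≤ 4 → X.ncard ≤ 7 := fun X hX hr => by
    have := S2.ncard_le_of_eRk_le_of_not_nullity M 4 9 (by norm_num) h4 hX (r := 4) (by norm_num) (by exact_mod_cast hr)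
    omega
  have hEcard : M.ground_finite.toFinset.card = 13 + 12 := by
    rw [← Set.ncard_eq_toFinset_card _ M.ground_finite]; exact hn
  have hU := topCount_le_flat_sharp M 13 12 (by norm_num) (by norm_num) hR hn hfree 8 7 hflat hflat' (by norm_num) (by norm_num)
    29 297 2760 hs3 hs4 hs5
  have hU' : Matroid.topCount M 13 5 ≤ 302926 := by
    have h : (Matroid.topCount M 13 5 : ℚ) ≤ 302926 := by
      refine hU.trans ?_
      norm_num [Finset.sum_range_succ, Nat.choose]
    exact_mod_cast h
  have hA := ncard_eRk_le_five_le_flats M 13 12 (by norm_num) hR hn hfree 8 7 hflat hflat' (by norm_num) (by norm_num)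
    (by norm_num) (by norm_num) 29 297 2760 hs3 hs4 hs5
  have hA' : ({X : Set α | X ⊆ M.E ∧ M.eRk X ≤ 5}.ncard : ℚ) ≤ 1819578 / 5 := by
    refine hA.trans ?_
    norm_num [Finset.sum_range_succ, Nat.choose]
  have hS' : {X : Set α | X ⊆ M.E ∧ M.eRk X = M.eRank}.ncard ≤ 16777216 := by
    have hS := Matroid.ncard_spanning_le (M := M) hd
    rw [hEcard] at hS
    exact hS.trans (by decide)
  rw [RLS_iff]
  exact c025_core_five_cell_of_counts_xqictq5g M 13 12 (by norm_num) hR hn 302926 hU' _ hA' 16777216 hS'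
    9480 (by norm_num) (phiK 13 5) (by rw [phiK_thirteen_five]; norm_num) ⟨524, by norm_num, by norm_num, by norm_num⟩

end ThmN

end PercRepro
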